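import Summits.Parity.GeneralizedHardyLittlewood.Theorems.GreenTaoLevelTwoMNTwoTypeIIBranch
import Summits.Parity.GeneralizedHardyLittlewood.Theorems.GreenTaoLevelTwoMNTwoTypeIIParams

/-!
# Route `GreenTaoLevelTwo`, crux `MNTwo` (stmt-Parity-21276), line `birth`, stub `stub_mnVertical`:
# the type II half of Proposition 22 at the budget scale from Lemma 24 (GT 2008b §10)

Block H4 / R4-II (budget form) of the `stub_mnVertical` census (B. Green, T. Tao, *Quadratic
uniformity of the Möbius function*, Ann. Inst. Fourier 58 (2008) = arXiv:math/0606087, §10: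
"In Lemma 24 take `L = M := εX^{1/2}/10` and `s := d`, `t := w` … All the conditions of Lemma 24
are thus satisfied").  Def-free: the hypothesis `hII` of
`…MNTwoPropTwentyTwoBudget.prop22_budget_of_branches` (the type II half of Prop. 22 at the budget
scale) is derived from LEMMA 24 IN POLYNOMIAL FORM (`hL`, module constant-free: exponents `A₂`,
constants `C₂` with `Q, 1/ε ≤ C₂η^{-A₂}` at level `η`; the type II alternative of the dichotomy is
passed verbatim, the side conditions on `s, t, L, M` are the printed ones with `D = K`,
`W = ⌊2N/K⌋`, and BOTH gauge conditions `LM·ν(st) ≤ ε²` and `LM·ν(st) ≤ ρ` are supplied) through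
`…MNTwoTypeIIBranch.prop22_of_typeII_core`, choosing `D' = ⌊K√ρ₁⌋`,
`ℓ = ⌊min(ε,ρ)/(10√ρ₁)⌋` and verifying the compatibility, budget, size and density conditions for
`A₀ ≥ A₂'(a, A₂)` and `N ≥ N₂(A₀)` (`log^r x = o(x^{1/4})`).

* `typeII_half` — `hL → hII` (all torus dimensions `k`).

References: [GreenTao2008QuadraticMobius] arXiv:math/0606087 §10 (end of the type II case),
Lemma 24.
-/

noncomputable section

open Finset Real Filter Asymptotics
open scoped ComplexConjugate

namespace Summit.Parity.GeneralizedHardyLittlewood.GreenTaoLevelTwoMNTwoTypeIIHalf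

open Summit.Parity.GeneralizedHardyLittlewood.GreenTaoLevelTwoMNTwoTypeIIBranch
  (prop22_of_typeII_core)
open Summit.Parity.GeneralizedHardyLittlewood.GreenTaoLevelTwoMNTwoBohrGauge (bohrGauge_nonneg)
open Summit.Parity.GeneralizedHardyLittlewood.GreenTaoLevelTwoMNTwoTypeIIParams (typeII_params)

set_option maxHeartbeats 400000 in
/-- **The type II half of Proposition 22 at the budget scale, from Lemma 24 in polynomial form
(GT 2008b §10).**  `hL` is Lemma 24 (Type II sum implies major arc) with explicit polynomial
dependence on the level `η` (module docstring); the conclusion is the hypothesis `hII` of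
`…MNTwoPropTwentyTwoBudget.prop22_budget_of_branches` verbatim.
[cite: GreenTao2008QuadraticMobius, §10 (end of the type II case), Lemma 24] -/
theorem typeII_half (k : ℕ)
    (hL : ∃ (A₂ : ℕ) (C₂ : ℝ), 1 ≤ C₂ ∧ ∀ (N : ℕ), 2 ≤ N →
      ∀ (α : Fin k → ℝ) (n₀ : ℤ) (ρ : ℝ), 0 < ρ → 100000 * ρ < 1 →
      ∀ (φ : ℤ → UnitAddCircle),
        (∀ n a b c : ℤ,
          (⨆ i : Fin k, ‖((((n - n₀ : ℤ) : ℝ) * α i : ℝ) : AddCircle (1 : ℝ))‖) +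
              |((n - n₀ : ℤ) : ℝ)| / N < 100 * ρ →
          (⨆ i : Fin k, ‖((((n + a - n₀ : ℤ) : ℝ) * α i : ℝ) : AddCircle (1 : ℝ))‖) +
              |((n + a - n₀ : ℤ) : ℝ)| / N < 100 * ρ →
          (⨆ i : Fin k, ‖((((n + b - n₀ : ℤ) : ℝ) * α i : ℝ) : AddCircle (1 : ℝ))‖) +
              |((n + b - n₀ : ℤ) : ℝ)| / N < 100 * ρ →
          (⨆ i : Fin k, ‖((((n + c - n₀ : ℤ) : ℝ) * α i : ℝ) : AddCircle (1 : ℝ))‖) +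
              |((n + c - n₀ : ℤ) : ℝ)| / N < 100 * ρ →
          (⨆ i : Fin k, ‖((((n + a + b - n₀ : ℤ) : ℝ) * α i : ℝ) : AddCircle (1 : ℝ))‖) +
              |((n + a + b - n₀ : ℤ) : ℝ)| / N < 100 * ρ →
          (⨆ i : Fin k, ‖((((n + a + c - n₀ : ℤ) : ℝ) * α i : ℝ) : AddCircle (1 : ℝ))‖) +
              |((n + a + c - n₀ : ℤ) : ℝ)| / N < 100 * ρ →
          (⨆ i : Fin k, ‖((((n + b + c - n₀ : ℤ) : ℝ) * α i : ℝ) : AddCircle (1 : ℝ))‖) +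
              |((n + b + c - n₀ : ℤ) : ℝ)| / N < 100 * ρ →
          (⨆ i : Fin k, ‖((((n + a + b + c - n₀ : ℤ) : ℝ) * α i : ℝ) : AddCircle (1 : ℝ))‖) +
              |((n + a + b + c - n₀ : ℤ) : ℝ)| / N < 100 * ρ →
          φ (n + a + b + c) - φ (n + a + b) - φ (n + a + c) - φ (n + b + c)
            + φ (n + a) + φ (n + b) + φ (n + c) - φ n = 0) →
      ∀ (ψ : ℤ → ℝ), (∀ n, 0 ≤ ψ n) → (∀ n, ψ n ≤ 1) →
        (∀ n, ψ n ≠ 0 →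
          (⨆ i : Fin k, ‖((((n - n₀ : ℤ) : ℝ) * α i : ℝ) : AddCircle (1 : ℝ))‖) +
            |((n - n₀ : ℤ) : ℝ)| / N < ρ) →
        (∀ n, ψ n ≠ 0 → (N : ℤ) < n ∧ n ≤ 2 * N) →
        (∀ n n' : ℤ, |ψ n - ψ n'| ≤
          (⨆ i : Fin k, ‖((((n - n' : ℤ) : ℝ) * α i : ℝ) : AddCircle (1 : ℝ))‖) +
            |((n - n' : ℤ) : ℝ)| / N) →
      ∀ (η : ℝ), 0 < η → η ≤ 1 →
      ∀ (K w' : ℕ), C₂ / η ^ A₂ ≤ (K : ℝ) → C₂ / η ^ A₂ ≤ ((2 * N / K : ℕ) : ℝ) → K ≤ N →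
        w' ∈ Icc 1 (2 * N / K) →
        η * ((2 * N / K : ℕ) : ℝ) - 1 ≤ #((Icc 1 (2 * N / K)).filter fun w => w ≠ w' ∧
          η * K ≤ ‖∑ d ∈ Ioc K (min (2 * K) (min (2 * N / w) (2 * N / w'))),
            ((ψ ((d * w : ℕ) : ℤ) : ℝ) : ℂ) * (AddCircle.toCircle (φ ((d * w : ℕ) : ℤ)) : ℂ) *
              conj (((ψ ((d * w' : ℕ) : ℤ) : ℝ) : ℂ) *
                (AddCircle.toCircle (φ ((d * w' : ℕ) : ℤ)) : ℂ))‖) →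
      ∀ (s t : ℤ) (L M : ℕ),
        (L : ℝ) * |(s : ℝ)| ≤ η ^ A₂ / C₂ * K →
        (M : ℝ) * |(t : ℝ)| ≤ η ^ A₂ / C₂ * ((2 * N / K : ℕ) : ℝ) →
        C₂ / η ^ A₂ ≤ (L : ℝ) → C₂ / η ^ A₂ ≤ (M : ℝ) →
        (L : ℝ) * (M : ℝ) *
            ((⨆ i : Fin k, ‖((((s * t : ℤ) : ℝ) * α i : ℝ) : AddCircle (1 : ℝ))‖) +
              |((s * t : ℤ) : ℝ)| / N) ≤ (η ^ A₂ / C₂) ^ 2 →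
        (L : ℝ) * (M : ℝ) *
            ((⨆ i : Fin k, ‖((((s * t : ℤ) : ℝ) * α i : ℝ) : AddCircle (1 : ℝ))‖) +
              |((s * t : ℤ) : ℝ)| / N) ≤ ρ →
        ∃ q : ℕ, 1 ≤ q ∧ (q : ℝ) ≤ C₂ / η ^ A₂ ∧
          ‖q • (φ (n₀ + s * t + s * t) - φ (n₀ + s * t) - φ (n₀ + s * t) + φ n₀)‖ ≤
            C₂ / η ^ A₂ / ((L : ℝ) ^ 2 * (M : ℝ) ^ 2)) :
    ∀ (aη cη : ℝ), 0 < aη → 0 < cη → ∃ A₂ : ℝ, ∀ A₀ : ℝ, A₂ ≤ A₀ →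
      ∃ N₂ : ℕ, ∀ N : ℕ, N₂ ≤ N → 2 ≤ N →
      ∀ (α : Fin k → ℝ) (n₀ : ℤ) (ρ : ℝ), 0 < ρ → 100000 * ρ < 1 → (Real.log N ^ aη)⁻¹ ≤ ρ →
      ∀ (φ : ℤ → UnitAddCircle),
        (∀ n a b c : ℤ,
          (⨆ i : Fin k, ‖((((n - n₀ : ℤ) : ℝ) * α i : ℝ) : AddCircle (1 : ℝ))‖) +
              |((n - n₀ : ℤ) : ℝ)| / N < 100 * ρ →
          (⨆ i : Fin k, ‖((((n + a - n₀ : ℤ) : ℝ) * α i : ℝ) : AddCircle (1 : ℝ))‖) +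
              |((n + a - n₀ : ℤ) : ℝ)| / N < 100 * ρ →
          (⨆ i : Fin k, ‖((((n + b - n₀ : ℤ) : ℝ) * α i : ℝ) : AddCircle (1 : ℝ))‖) +
              |((n + b - n₀ : ℤ) : ℝ)| / N < 100 * ρ →
          (⨆ i : Fin k, ‖((((n + c - n₀ : ℤ) : ℝ) * α i : ℝ) : AddCircle (1 : ℝ))‖) +
              |((n + c - n₀ : ℤ) : ℝ)| / N < 100 * ρ →
          (⨆ i : Fin k, ‖((((n + a + b - n₀ : ℤ) : ℝ) * α i : ℝ) : AddCircle (1 : ℝ))‖) +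
              |((n + a + b - n₀ : ℤ) : ℝ)| / N < 100 * ρ →
          (⨆ i : Fin k, ‖((((n + a + c - n₀ : ℤ) : ℝ) * α i : ℝ) : AddCircle (1 : ℝ))‖) +
              |((n + a + c - n₀ : ℤ) : ℝ)| / N < 100 * ρ →
          (⨆ i : Fin k, ‖((((n + b + c - n₀ : ℤ) : ℝ) * α i : ℝ) : AddCircle (1 : ℝ))‖) +
              |((n + b + c - n₀ : ℤ) : ℝ)| / N < 100 * ρ →
          (⨆ i : Fin k, ‖((((n + a + b + c - n₀ : ℤ) : ℝ) * α i : ℝ) : AddCircle (1 : ℝ))‖) +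
              |((n + a + b + c - n₀ : ℤ) : ℝ)| / N < 100 * ρ →
          φ (n + a + b + c) - φ (n + a + b) - φ (n + a + c) - φ (n + b + c)
            + φ (n + a) + φ (n + b) + φ (n + c) - φ n = 0) →
      ∀ (ψ : ℤ → ℝ), (∀ n, 0 ≤ ψ n) → (∀ n, ψ n ≤ 1) →
        (∀ n, ψ n ≠ 0 →
          (⨆ i : Fin k, ‖((((n - n₀ : ℤ) : ℝ) * α i : ℝ) : AddCircle (1 : ℝ))‖) +
            |((n - n₀ : ℤ) : ℝ)| / N < ρ) →
        (∀ n, ψ n ≠ 0 → (N : ℤ) < n ∧ n ≤ 2 * N) →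
        (∀ n n' : ℤ, |ψ n - ψ n'| ≤
          (⨆ i : Fin k, ‖((((n - n' : ℤ) : ℝ) * α i : ℝ) : AddCircle (1 : ℝ))‖) +
            |((n - n' : ℤ) : ℝ)| / N) →
      ∀ (η : ℝ), cη * (Real.log N ^ aη)⁻¹ ≤ η → η ≤ 1 →
      ∀ (u K w' : ℕ), N < (u + 1) ^ 4 → u ≤ K → K * u ≤ 2 * N → w' ∈ Icc 1 (2 * N / K) →
        η * ((2 * N / K : ℕ) : ℝ) - 1 ≤ #((Icc 1 (2 * N / K)).filter fun w => w ≠ w' ∧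
          η * K ≤ ‖∑ d ∈ Ioc K (min (2 * K) (min (2 * N / w) (2 * N / w'))),
            ((ψ ((d * w : ℕ) : ℤ) : ℝ) : ℂ) * (AddCircle.toCircle (φ ((d * w : ℕ) : ℤ)) : ℂ) *
              conj (((ψ ((d * w' : ℕ) : ℤ) : ℝ) : ℂ) *
                (AddCircle.toCircle (φ ((d * w' : ℕ) : ℤ)) : ℂ))‖) →
      ∀ ρ₁ : ℝ, ρ₁ = ((Real.log N ^ A₀) ^ ((k + 2) * (4 + 4 ^ (k + 2))))⁻¹ →
        ∃ (D : ℕ) (𝒟 : Finset ℕ), 1 ≤ D ∧ 𝒟 ⊆ Icc 1 D ∧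
          4 * (32 * 38 ^ k) * (D : ℝ) ≤ (ρ₁ / 16) ^ (k + 1) * N / 2 ∧
          ρ₁ * (D : ℝ) ^ 2 / Real.log N ^ A₀ ≤ (#𝒟 : ℝ) ^ 2 ∧
          ∀ d ∈ 𝒟, ∀ n ∈ (Finset.Ioo (-(N : ℤ)) N).filter fun n : ℤ =>
              (∀ i, ‖(((n : ℝ) * α i : ℝ) : AddCircle (1 : ℝ))‖ + |(n : ℝ)| / N < ρ₁) ∧
                |(n : ℝ)| / N < ρ₁,
            (d : ℤ) ∣ n → ∃ q : ℕ, 1 ≤ q ∧ (q : ℝ) ≤ Real.log N ^ A₀ ∧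
              ‖((q : ℤ)) • (φ (n₀ + n + n) - φ (n₀ + n) - φ (n₀ + n) + φ n₀)‖ ≤
                Real.log N ^ A₀ * ρ₁ ^ 2 := by
  classical
  obtain ⟨A₂, C₂, hC₂, hL24⟩ := hL
  intro aη cη haη hcη
  have hC₂pos : 0 < C₂ := by linarith
  obtain ⟨A₂', hA⟩ := typeII_params k A₂ hC₂ haη hcη
  refine ⟨A₂', ?_⟩
  intro A₀ hA₀
  obtain ⟨N₂, hN₂⟩ := hA A₀ hA₀
  refine ⟨N₂, ?_⟩
  intro N hN h2N α n₀ ρ hρ hρ1 hρa φ hφ ψ hψ0 hψ1 hsupp hsuppN hlip η hηc hη1 u K w' hu4 huK hKu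
    hw' hgood ρ₁ hρ₁
  obtain ⟨hηpos, hρ₁pos, hdens, hQP, hQPe, hlarge, ℓ, σ, x, ε', hℓ1, hσpos, hσσ, hσ1, hσlow, hε'pos,
    hε'ε, hx, hxpos, hℓx, hℓQ, hℓν, hM₀⟩ := hN₂ N hN h2N ρ η hρ hρ1 hρa hηc hη1 ρ₁ hρ₁
  -- abbreviations (opaque): `Pe = P^{e(k+1)}`, `Kk = 16^{k+2}·32·38ᵏ`
  obtain ⟨Pe, hPe⟩ : ∃ Pe : ℝ, Pe = (Real.log N ^ A₀) ^ ((k + 2) * (4 + 4 ^ (k + 2)) * (k + 1)) :=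
    ⟨_, rfl⟩
  obtain ⟨Kk, hKk⟩ : ∃ Kk : ℝ, Kk = 16 ^ (k + 2) * (32 * 38 ^ k) := ⟨_, rfl⟩
  rw [← hPe] at hQPe hlarge hσlow
  rw [← hKk] at hlarge
  have hN1 : 1 ≤ N := by omega
  have hNpos : (0 : ℝ) < N := by exact_mod_cast (show 0 < N by omega)
  have hεηpos : 0 < η ^ A₂ / C₂ := by positivity
  have hPepos : 0 < Pe := lt_of_lt_of_le (by positivity) hQPe
  have hKk16 : 16 ≤ Kk := by
    rw [hKk]
    have h1 : (16 : ℝ) ≤ 16 ^ (k + 2) := by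
      calc (16 : ℝ) = 16 ^ 1 := (pow_one _).symm
        _ ≤ 16 ^ (k + 2) := pow_le_pow_right₀ (by norm_num) (by omega)
    have h2 : (1 : ℝ) ≤ 32 * 38 ^ k := by
      have := one_le_pow₀ (M₀ := ℝ) (a := 38) (n := k) (by norm_num); linarith
    nlinarith
  have hQη1 : 1 ≤ C₂ / η ^ A₂ := by
    rw [le_div_iff₀ (by positivity), one_mul]; exact (pow_le_one₀ hηpos.le hη1).trans hC₂
  have hPe1 : 1 ≤ Pe := hQη1.trans hQPe
  -- `u`, `K` are large: `(u+1) ≥ N^{1/4} ≥ 4 Kk P^{e(k+1)}`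
  have hν4 : ((N : ℝ) ^ ((1 : ℝ) / 4)) ^ 4 = N := by
    rw [← Real.rpow_mul_natCast hNpos.le]; norm_num
  have hu1r : (N : ℝ) ^ ((1 : ℝ) / 4) ≤ (u : ℝ) + 1 := by
    by_contra hcon
    push Not at hcon
    have h1 : ((u : ℝ) + 1) ^ 4 < ((N : ℝ) ^ ((1 : ℝ) / 4)) ^ 4 :=
      pow_lt_pow_left₀ hcon (by positivity) (by norm_num)
    rw [hν4] at h1
    have h2 : (N : ℝ) < ((u : ℝ) + 1) ^ 4 := by exact_mod_cast hu4
    linarith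
  -- `u ≥ 2` and `u ≥ (N^{1/4})/2`
  have hKP : (64 : ℝ) ≤ 4 * Kk * Pe := by
    calc (64 : ℝ) = 4 * (16 * 1) := by norm_num
      _ ≤ 4 * (Kk * Pe) := by gcongr
      _ = 4 * Kk * Pe := by ring
  have hu_half : (N : ℝ) ^ ((1 : ℝ) / 4) / 2 ≤ u := by
    have : (2 : ℝ) ≤ (N : ℝ) ^ ((1 : ℝ) / 4) := by linarith [hlarge, hKP]
    linarith
  have hu2 : 2 ≤ u := by
    have h1 : (6 : ℝ) ≤ (N : ℝ) ^ ((1 : ℝ) / 4) := by linarith [hlarge, hKP]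
    have : (2 : ℝ) ≤ u := by linarith
    exact_mod_cast this
  have hKN : K ≤ N := by
    have : K * 2 ≤ K * u := Nat.mul_le_mul_left K hu2
    omega
  have hK1 : 1 ≤ K := le_trans (by omega) huK
  have hKr : (0 : ℝ) < K := by exact_mod_cast hK1
  -- `W = ⌊2N/K⌋ ≥ N/K`
  have hW : (N : ℝ) / K ≤ ((2 * N / K : ℕ) : ℝ) := by
    rw [div_le_iff₀ hKr]
    have h1 : (2 * N / K) * K + K > 2 * N := by
      have := Nat.lt_div_mul_add (a := 2 * N) (b := K) (by omega)
      linarith [Nat.div_mul_le_self (2 * N) K, this]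
    have h2 : N ≤ (2 * N / K) * K := by
      have := Nat.div_mul_le_self (2 * N) K
      have hKN' := hKN
      omega
    exact_mod_cast h2
  -- `y = K σ ≥ 2`, `D' = ⌊y⌋`
  obtain ⟨y, hy⟩ : ∃ y : ℝ, y = (K : ℝ) * σ := ⟨_, rfl⟩
  have hypos : 0 < y := by rw [hy]; positivity
  have hKur : (u : ℝ) ≤ K := by exact_mod_cast huK
  have hy2 : 2 ≤ y := by
    -- `y = Kσ ≥ uσ ≥ (N^{1/4}/2) σ ≥ 2Kk P^{e₁(k+1)} σ ≥ 2Kk ≥ 2`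
    have h1 : (N : ℝ) ^ ((1 : ℝ) / 4) / 2 * σ ≤ y := by
      rw [hy]; exact mul_le_mul_of_nonneg_right (hu_half.trans hKur) hσpos.le
    have h2 : 2 * Kk * (Pe * σ) ≤
        (N : ℝ) ^ ((1 : ℝ) / 4) / 2 * σ := by
      have := mul_le_mul_of_nonneg_right hlarge (show 0 ≤ σ / 2 by positivity)
      calc 2 * Kk * (Pe * σ)
          = 4 * Kk * Pe * (σ / 2) := by ring
        _ ≤ (N : ℝ) ^ ((1 : ℝ) / 4) * (σ / 2) := this
        _ = (N : ℝ) ^ ((1 : ℝ) / 4) / 2 * σ := by ring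
    have h3 : 1 ≤ Pe * σ := by
      have := mul_le_mul_of_nonneg_left hσlow (show (0:ℝ) ≤ Pe
        by positivity)
      rwa [mul_inv_cancel₀ (by positivity)] at this
    have h4 : 2 * Kk * 1 ≤ 2 * Kk * (Pe * σ) :=
      mul_le_mul_of_nonneg_left h3 (by positivity)
    linarith [h1, h2, h4, hKk16]
  obtain ⟨D', hD'⟩ : ∃ D' : ℕ, D' = ⌊y⌋₊ := ⟨_, rfl⟩
  have hD'y : (D' : ℝ) ≤ y := by rw [hD']; exact Nat.floor_le hypos.le
  have hD'low : y / 2 ≤ D' := by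
    have h1 : y < (D' : ℝ) + 1 := by rw [hD']; exact Nat.lt_floor_add_one y
    linarith
  have hD'1 : 1 ≤ D' := by
    have : (1 : ℝ) ≤ D' := by linarith
    exact_mod_cast this
  have hD'pos : (0 : ℝ) < D' := by exact_mod_cast hD'1
  -- compatibility inequalities of `prop22_of_typeII_core`
  have hℓD : (ℓ : ℝ) * D' ≤ η ^ A₂ / C₂ * K := by
    calc (ℓ : ℝ) * D' ≤ x * y := mul_le_mul hℓx hD'y hD'pos.le hxpos.le
      _ = ε' * K / 10 := by rw [hx, hy]; field_simp
      _ ≤ η ^ A₂ / C₂ * K := by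
          have : ε' * K ≤ η ^ A₂ / C₂ * K := mul_le_mul_of_nonneg_right hε'ε hKr.le
          have h0 : 0 ≤ η ^ A₂ / C₂ * K := by positivity
          linarith
  have hℓW : (ℓ : ℝ) * (2 * N * ρ₁) ≤ η ^ A₂ / C₂ * ((2 * N / K : ℕ) : ℝ) * D' := by
    -- LHS ≤ x · 2Nρ₁ = ε' N σ / 5 ; RHS ≥ εη (N/K) (Kσ/2) = εη N σ / 2
    have h1 : (ℓ : ℝ) * (2 * N * ρ₁) ≤ ε' * N * σ / 5 := by
      calc (ℓ : ℝ) * (2 * N * ρ₁) ≤ x * (2 * N * ρ₁) :=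
            mul_le_mul_of_nonneg_right hℓx (by positivity)
        _ = ε' * N * σ / 5 := by rw [hx, ← hσσ]; field_simp; ring
    have h2 : η ^ A₂ / C₂ * N * σ / 2 ≤ η ^ A₂ / C₂ * ((2 * N / K : ℕ) : ℝ) * D' := by
      have h3 : (N : ℝ) * σ / 2 ≤ ((2 * N / K : ℕ) : ℝ) * D' := by
        calc (N : ℝ) * σ / 2 = (N : ℝ) / K * (y / 2) := by rw [hy]; field_simp
          _ ≤ ((2 * N / K : ℕ) : ℝ) * D' := mul_le_mul hW hD'low (by positivity) (by positivity)
      have := mul_le_mul_of_nonneg_left h3 hεηpos.le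
      linarith [this]
    have h4 : ε' * N * σ / 5 ≤ η ^ A₂ / C₂ * N * σ / 2 := by
      have h5 := mul_le_mul_of_nonneg_right hε'ε (show 0 ≤ (N : ℝ) * σ by positivity)
      have h6 : 0 ≤ η ^ A₂ / C₂ * ((N : ℝ) * σ) := by positivity
      have e1 : ε' * N * σ / 5 = (ε' * ((N : ℝ) * σ)) / 5 := by ring
      have e2 : η ^ A₂ / C₂ * N * σ / 2 = (η ^ A₂ / C₂ * ((N : ℝ) * σ)) / 2 := by ring
      rw [e1, e2]
      linarith
    linarith
  -- size: `4·32·38ᵏ D' ≤ (ρ₁/16)^{k+1} N/2`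
  have hsize : 4 * (32 * 38 ^ k) * (D' : ℝ) ≤ (ρ₁ / 16) ^ (k + 1) * N / 2 := by
    -- `D' ≤ Kσ ≤ K`, `K u ≤ 2N`, `u ≥ N^{1/4}/2 ≥ 2Kk P^{e₁(k+1)}`, `ρ₁^{k+1} = (P^{e₁(k+1)})⁻¹`
    have hρpow : ρ₁ ^ (k + 1) = Pe⁻¹ := by
      rw [hPe, hρ₁, inv_pow, ← pow_mul]
    have hD'K : (D' : ℝ) ≤ K := by
      calc (D' : ℝ) ≤ y := hD'y
        _ = K * σ := hy
        _ ≤ K * 1 := mul_le_mul_of_nonneg_left hσ1 hKr.le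
        _ = K := mul_one _
    have hKu2 : (K : ℝ) * u ≤ 2 * N := by exact_mod_cast hKu
    have hularge : 2 * Kk * Pe ≤ u := by
      linarith [hlarge, hu_half]
    -- `4·32·38^k·D'·(2·16^{k+1}·Pe) ≤ N`
    have key : 4 * (32 * 38 ^ k) * (D' : ℝ) * (2 * 16 ^ (k + 1) *
        Pe) ≤ N := by
      calc 4 * (32 * 38 ^ k) * (D' : ℝ) * (2 * 16 ^ (k + 1) * Pe)
          ≤ 4 * (32 * 38 ^ k) * (K : ℝ) * (2 * 16 ^ (k + 1) *
              Pe) := by gcongr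
        _ = (K : ℝ) * (Kk * Pe) / 2 := by
            rw [hKk]; ring
        _ ≤ (K : ℝ) * u / 2 := by
            have : Kk * Pe ≤ u := by
              have h0 : 0 ≤ Kk * Pe := by positivity
              linarith [hularge]
            have := mul_le_mul_of_nonneg_left this hKr.le
            linarith
        _ ≤ N := by linarith
    rw [div_pow, hρpow]
    have e6 : (Pe)⁻¹ / 16 ^ (k + 1) * (N : ℝ) / 2 =
        (N : ℝ) / (2 * 16 ^ (k + 1) * Pe) := by
      field_simp
    rw [e6, le_div_iff₀ (by positivity)]
    exact key
  -- `K` and `W = ⌊2N/K⌋` are large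
  have hPeu : 2 * Pe ≤ u := by
    have h1 : 2 * Kk * Pe ≤ u := by linarith [hlarge, hu_half]
    have h2 : 16 * Pe ≤ Kk * Pe :=
      mul_le_mul_of_nonneg_right hKk16 (by positivity)
    have h3 : 0 ≤ Pe := by positivity
    linarith
  have hKlarge : C₂ / η ^ A₂ ≤ (K : ℝ) := by
    have : Pe ≤ u := by
      have h0 : 0 ≤ Pe := by positivity
      linarith
    exact hQPe.trans (this.trans hKur)
  have hWlarge : C₂ / η ^ A₂ ≤ ((2 * N / K : ℕ) : ℝ) := by
    have hKu2 : (K : ℝ) * u ≤ 2 * N := by exact_mod_cast hKu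
    have h1 : (u : ℝ) / 2 ≤ (N : ℝ) / K := by
      rw [div_le_div_iff₀ (by norm_num) hKr]; linarith
    have h2 : Pe ≤ (u : ℝ) / 2 := by linarith
    exact hQPe.trans (h2.trans (h1.trans hW))
  -- Lemma 24 at `N`, then Prop. 22 at one scale (type II case)
  exact prop22_of_typeII_core k hN1 α n₀ φ hD'1 hℓ1 hρ₁pos (Q := C₂ / η ^ A₂)
    (M₀ := C₂ / η ^ A₂) (cD := η ^ A₂ / C₂ * K) (cW := η ^ A₂ / C₂ * ((2 * N / K : ℕ) : ℝ))
    (ℓ₀ := C₂ / η ^ A₂) (cν := min ((η ^ A₂ / C₂) ^ 2) ρ) (P := Real.log N ^ A₀)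
    (fun s t L M h1 h2 h3 h4 h5 => hL24 N h2N α n₀ ρ hρ hρ1 φ hφ ψ hψ0 hψ1 hsupp hsuppN hlip η
      hηpos hη1 K w' hKlarge hWlarge hKN hw' hgood s t L M h1 h2 h3 h4
      (h5.trans (min_le_left _ _)) (h5.trans (min_le_right _ _)))
    hℓD hℓW hℓQ hℓν hQP hM₀ hdens hsize

end Summit.Parity.GeneralizedHardyLittlewood.GreenTaoLevelTwoMNTwoTypeIIHalf
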